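import Summits.HodgeConjecture.HodgeConjecture.Theorems.AnchorTransportTargetIffHodgeConjecture

/-!
# Route AnchorTransport — the target is invariant under the relative-projectivity repair
(helpers for item stmt-HodgeConjecture-1079)

`Target = VariationalHodge ∧ AnchorExistence` inlines the crux `VariationalHodge` (stmt-1076), whose
families `f : 𝒳 ⟶ S` are smooth PROPER with projective fibres (`IsSmoothProjectiveFamily`) but carry
no relative projective embedding, whereas the printed conjecture it formalises (Charles–Schnell,
Conj. 11.3.1 = Grothendieck 1966, fn. 13) and every deformation engine in the tree
(`Andre1996_deformation`, `deligne_globalInvariantCycles`, …) are about PROJECTIVE morphisms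
`𝒳 ↪ ℙᴺ × S → S` (prover verdict on stmt-1076, 2026-08-16).  The proposed repair adds the conjunct

  `∃ (N : ℕ) (ι : 𝒳 ⟶ ℙᴺ ⊗ S), IsClosedImmersion ι.left ∧ ι ≫ snd = f`

as a hypothesis of `VariationalHodge` (call the result `V′`, WEAKER than `V`) and inside the
`∃`-block of `AnchorExistence` (`An′`, STRONGER than `An`).  This file certifies that the repair is
truth-invariant for the target and for the route's assembly:

* `anchorTransport_projVariationalHodge_of_variationalHodge : V → V′`,
  `anchorTransport_anchorExistence_of_projAnchorExistence : An′ → An` (forgetting the embedding);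
* `anchorTransport_hodgeConjecture_of_proj : V′ → An′ → HodgeConjecture` — the route's deciding
  theorem `closes` re-run verbatim: `An′` SUPPLIES the embedding that `V′` CONSUMES;
* `exists_isClosedImmersion_toSpecOver` — the constant family `X ⟶ Spec ℂ` of a projective `X` is
  relatively projective (`X ↪ ℙᴺ ≅ ℙᴺ ⊗ Spec ℂ`), whence the constant-family anchor in the repaired
  form (`anchorTransport_projAnchor_of_mem_algebraicClasses`) and
  `HodgeConjecture → An′`; `HodgeConjecture → V′` is fibrewise as before;
* `anchorTransport_projTarget_iff_hodgeConjecture : (V′ ∧ An′) ↔ HodgeConjecture` and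
  `anchorTransport_projTarget_iff_target : (V′ ∧ An′) ↔ Target`.

So `Target`, `V ∧ An` and `V′ ∧ An′` are pairwise equivalent (all three ↔ `HodgeConjecture`):
restating the cruxes with relative projectivity changes what a prover of `VariationalHodge` may use,
not what the route proves.
-/

noncomputable section

-- `Summit.HodgeConjecture.HodgeConjecture.Theorems` is the mandated namespace (single-problem summit:
-- Problem = Summit), which `linter.dupNamespace` flags on every declaration; the lakefile turns the
-- linter off tree-wide (weak option), restated here so stand-alone elaboration is warning-free too.
set_option linter.dupNamespace false

open CategoryTheory AlgebraicGeometry CategoryTheory.Limits MonoidalCategory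
open Literature.AlgebraicGeometry Literature.AlgebraicGeometry.Motives
  Literature.AlgebraicGeometry.HodgeTheory Literature.AlgebraicTopology.SingularHomology
open Summit.HodgeConjecture.HodgeConjecture.Theses.AnchorTransport

namespace Summit.HodgeConjecture.HodgeConjecture.Theorems

/-! ### The easy comparisons `V → V′` and `An′ → An` -/

/-- **`V → V′`**: the repaired variational statement has one more hypothesis (a relative projective
embedding of the family), so it follows from the crux as filed by ignoring it. [folklore] -/
theorem anchorTransport_projVariationalHodge_of_variationalHodge (hV : VariationalHodge)
    ⦃n : ℕ⦄ ⦃𝒳 S : SchemeOver ℂ⦄ (f : 𝒳 ⟶ S) (hf : IsSmoothProjectiveFamily f n)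
    (_hι : ∃ (N : ℕ) (ι : 𝒳 ⟶ projectiveSpace N ℂ ⊗ S), IsClosedImmersion ι.left ∧
      ι ≫ CartesianMonoidalCategory.snd (projectiveSpace N ℂ) S = f)
    (hirr : IrreducibleSpace S.left) (hsm : Smooth S.hom) (p : ℕ) (A : complexBetti 𝒳 (2 * p))
    (hA : ∀ s : ComplexPoints S, IsRationalClass (complexBetti.map (fiberι f s) (2 * p) A) ∧
      IsOfHodgeType n (fiberOver f s) (2 * p) p p (complexBetti.map (fiberι f s) (2 * p) A))
    (hs₀ : ∃ s₀ : ComplexPoints S,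
      complexBetti.map (fiberι f s₀) (2 * p) A ∈ algebraicClasses (fiberOver f s₀) p)
    (s : ComplexPoints S) :
    complexBetti.map (fiberι f s) (2 * p) A ∈ algebraicClasses (fiberOver f s) p :=
  hV f hf hirr hsm p A hA hs₀ s

/-- **`An′ → An`**: an anchor whose family carries a relative projective embedding is in particular
an anchor in the sense of `AnchorExistence` (forget the embedding). [folklore] -/
theorem anchorTransport_anchorExistence_of_projAnchorExistence
    (hAn : ∀ ⦃n : ℕ⦄ ⦃X : SchemeOver ℂ⦄, IsSmoothProjective n X →
      ∀ (p : ℕ) (c : complexBetti X (2 * p)), IsRationalClass c → IsOfHodgeType n X (2 * p) p p c →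
      ∃ (𝒳 S : SchemeOver ℂ) (f : 𝒳 ⟶ S) (s₁ s₀ : ComplexPoints S) (e : X ≅ fiberOver f s₁)
        (A : complexBetti 𝒳 (2 * p)),
        IsSmoothProjectiveFamily f n ∧
        (∃ (N : ℕ) (ι : 𝒳 ⟶ projectiveSpace N ℂ ⊗ S), IsClosedImmersion ι.left ∧
          ι ≫ CartesianMonoidalCategory.snd (projectiveSpace N ℂ) S = f) ∧
        IrreducibleSpace S.left ∧ Smooth S.hom ∧
        (∀ s : ComplexPoints S, IsRationalClass (complexBetti.map (fiberι f s) (2 * p) A) ∧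
          IsOfHodgeType n (fiberOver f s) (2 * p) p p (complexBetti.map (fiberι f s) (2 * p) A)) ∧
        complexBetti.map e.hom (2 * p) (complexBetti.map (fiberι f s₁) (2 * p) A) = c ∧
        complexBetti.map (fiberι f s₀) (2 * p) A ∈ algebraicClasses (fiberOver f s₀) p) :
    AnchorExistence := by
  unfold Summit.HodgeConjecture.HodgeConjecture.Theses.AnchorTransport.AnchorExistence
  intro n X hX p c hc hpp
  obtain ⟨𝒳, S, f, s₁, s₀, e, A, hf, -, hirr, hsm, hfib, hAc, hs₀⟩ := hAn hX p c hc hpp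
  exact ⟨𝒳, S, f, s₁, s₀, e, A, hf, hirr, hsm, hfib, hAc, hs₀⟩

/-! ### The repaired assembly: `V′ → An′ → HodgeConjecture` -/

/-- **The repaired cruxes still close the summit**: given a smooth projective `X` and a rational
`(p,p)` class `c`, `An′` provides a relatively projective anchor family `(f, ι, s₁, s₀, e, A)`;
`V′` — which now demands the embedding `ι` — transports algebraicity from the anchor fibre `s₀` to
`s₁`; `IsoInvariance` (proved, `IsoInvariance_holds`) moves it across `e : X ≅ 𝒳_{s₁}`; the
Hodge-model conjunct is `HodgeModels_holds`.  This is the route's deciding theorem `closes` with the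
embedding threaded through. [folklore] -/
theorem anchorTransport_hodgeConjecture_of_proj
    (hV : ∀ ⦃n : ℕ⦄ ⦃𝒳 S : SchemeOver ℂ⦄ (f : 𝒳 ⟶ S), IsSmoothProjectiveFamily f n →
      (∃ (N : ℕ) (ι : 𝒳 ⟶ projectiveSpace N ℂ ⊗ S), IsClosedImmersion ι.left ∧
        ι ≫ CartesianMonoidalCategory.snd (projectiveSpace N ℂ) S = f) →
      IrreducibleSpace S.left → Smooth S.hom → ∀ (p : ℕ) (A : complexBetti 𝒳 (2 * p)),
      (∀ s : ComplexPoints S, IsRationalClass (complexBetti.map (fiberι f s) (2 * p) A) ∧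
        IsOfHodgeType n (fiberOver f s) (2 * p) p p (complexBetti.map (fiberι f s) (2 * p) A)) →
      (∃ s₀ : ComplexPoints S,
        complexBetti.map (fiberι f s₀) (2 * p) A ∈ algebraicClasses (fiberOver f s₀) p) →
      ∀ s : ComplexPoints S, complexBetti.map (fiberι f s) (2 * p) A ∈ algebraicClasses (fiberOver f s) p)
    (hAn : ∀ ⦃n : ℕ⦄ ⦃X : SchemeOver ℂ⦄, IsSmoothProjective n X →
      ∀ (p : ℕ) (c : complexBetti X (2 * p)), IsRationalClass c → IsOfHodgeType n X (2 * p) p p c →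
      ∃ (𝒳 S : SchemeOver ℂ) (f : 𝒳 ⟶ S) (s₁ s₀ : ComplexPoints S) (e : X ≅ fiberOver f s₁)
        (A : complexBetti 𝒳 (2 * p)),
        IsSmoothProjectiveFamily f n ∧
        (∃ (N : ℕ) (ι : 𝒳 ⟶ projectiveSpace N ℂ ⊗ S), IsClosedImmersion ι.left ∧
          ι ≫ CartesianMonoidalCategory.snd (projectiveSpace N ℂ) S = f) ∧
        IrreducibleSpace S.left ∧ Smooth S.hom ∧
        (∀ s : ComplexPoints S, IsRationalClass (complexBetti.map (fiberι f s) (2 * p) A) ∧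
          IsOfHodgeType n (fiberOver f s) (2 * p) p p (complexBetti.map (fiberι f s) (2 * p) A)) ∧
        complexBetti.map e.hom (2 * p) (complexBetti.map (fiberι f s₁) (2 * p) A) = c ∧
        complexBetti.map (fiberι f s₀) (2 * p) A ∈ algebraicClasses (fiberOver f s₀) p) :
    _root_.HodgeConjecture := by
  intro n X hX
  refine (hodgeConjectureFor_iff_of_isSmoothProjective (HodgeModels_holds n X) hX).2 ?_
  intro p c hc hpp
  obtain ⟨𝒳, S, f, s₁, s₀, e, A, hf, hι, hirr, hsm, hfib, hAc, hs₀⟩ := hAn hX p c hc hpp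
  -- transport algebraicity from the anchor fibre `s₀` to `s₁` along the PROJECTIVE family …
  have h₁ := hV f hf hι hirr hsm p A hfib ⟨s₀, hs₀⟩ s₁
  -- … and across the isomorphism `e : X ≅ 𝒳_{s₁}`
  have h₂ := IsoInvariance_holds e p _ h₁
  rwa [hAc] at h₂

/-! ### The constant family is relatively projective, so `HodgeConjecture → An′` -/

section ConstantFamily

variable {n : ℕ} {X : SchemeOver ℂ}

/-- The unique map `Spec ℂ ⟶ 𝟙` of `ℂ`-schemes is an isomorphism (its underlying morphism is the
structure map of `Spec ℂ`, an isomorphism). [folklore] -/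
theorem isIso_toUnit_specOver : IsIso (CartesianMonoidalCategory.toUnit (specOver ℂ ℂ)) := by
  haveI : IsIso ((Over.forget _).map (CartesianMonoidalCategory.toUnit (specOver ℂ ℂ))) := by
    change IsIso (CartesianMonoidalCategory.toUnit (specOver ℂ ℂ)).left
    rw [Over.toUnit_left]
    exact CurveNet.isIso_specOver_self_hom ℂ
  exact isIso_of_reflects_iso _ (Over.forget _)

/-- The projection `P ⊗ Spec ℂ ⟶ P` is an isomorphism of `ℂ`-schemes (`Spec ℂ` is the unit up to
the iso `isIso_toUnit_specOver`; `fst = (P ◁ toUnit) ≫ ρ_P`). [folklore] -/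
theorem isIso_fst_specOver (P : SchemeOver ℂ) :
    IsIso (CartesianMonoidalCategory.fst P (specOver ℂ ℂ)) := by
  haveI := isIso_toUnit_specOver
  rw [← CartesianMonoidalCategory.whiskerLeft_toUnit_comp_rightUnitor_hom]
  infer_instance

/-- Morphisms of `ℂ`-schemes into `Spec ℂ` are unique. [folklore] -/
theorem hom_specOver_ext {Y : SchemeOver ℂ} (a b : Y ⟶ specOver ℂ ℂ) : a = b := by
  haveI := isIso_toUnit_specOver
  exact (cancel_mono (CartesianMonoidalCategory.toUnit (specOver ℂ ℂ))).1
    (CartesianMonoidalCategory.toUnit_unique _ _)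

/-- **The constant family of a projective `ℂ`-scheme is relatively projective**: a closed
`ℂ`-immersion `j : X ↪ ℙᴺ` gives the closed immersion `(j, X → Spec ℂ) : X ⟶ ℙᴺ ⊗ Spec ℂ`
(it is `j` followed by the inverse of the iso `ℙᴺ ⊗ Spec ℂ ⟶ ℙᴺ`), whose composite with the second
projection is the structure map `X ⟶ Spec ℂ` (Hartshorne II §4: `X` projective over `ℂ` iff
`X → Spec ℂ` is a projective morphism). [folklore] -/
theorem exists_isClosedImmersion_toSpecOver (hX : IsProjectiveOver X) :
    ∃ (N : ℕ) (ι : X ⟶ projectiveSpace N ℂ ⊗ specOver ℂ ℂ), IsClosedImmersion ι.left ∧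
      ι ≫ CartesianMonoidalCategory.snd (projectiveSpace N ℂ) (specOver ℂ ℂ) = toSpecOver X := by
  obtain ⟨N, j, hj⟩ := hX
  haveI := isIso_fst_specOver (projectiveSpace N ℂ)
  refine ⟨N, CartesianMonoidalCategory.lift j (toSpecOver X), ?_, hom_specOver_ext _ _⟩
  have hι : CartesianMonoidalCategory.lift j (toSpecOver X) =
      j ≫ inv (CartesianMonoidalCategory.fst (projectiveSpace N ℂ) (specOver ℂ ℂ)) := by
    rw [IsIso.eq_comp_inv, CartesianMonoidalCategory.lift_fst]
  haveI : IsIso (inv (CartesianMonoidalCategory.fst (projectiveSpace N ℂ) (specOver ℂ ℂ))).left := by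
    change IsIso ((Over.forget _).map (inv (CartesianMonoidalCategory.fst _ _)))
    infer_instance
  rw [hι, Over.comp_left]
  infer_instance

/-- **The constant-family anchor, repaired form.** An ALREADY algebraic rational `(p,p)` class `c`
on a smooth projective `X` of dimension `n` is anchored by the constant family `X ⟶ Spec ℂ` — now
recorded together with its relative projective embedding `X ↪ ℙᴺ ⊗ Spec ℂ`
(`exists_isClosedImmersion_toSpecOver`) — the point `s₁ = s₀ = 𝟙`, the fibre iso
`X ≅ X ×_{Spec ℂ} Spec ℂ` and `A = c`. [folklore] -/
theorem anchorTransport_projAnchor_of_mem_algebraicClasses (hX : IsSmoothProjective n X) (p : ℕ)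
    (c : complexBetti X (2 * p)) (hc : IsRationalClass c) (hpp : IsOfHodgeType n X (2 * p) p p c)
    (halg : c ∈ algebraicClasses X p) :
    ∃ (𝒳 S : SchemeOver ℂ) (f : 𝒳 ⟶ S) (s₁ s₀ : ComplexPoints S) (e : X ≅ fiberOver f s₁)
      (A : complexBetti 𝒳 (2 * p)),
      IsSmoothProjectiveFamily f n ∧
      (∃ (N : ℕ) (ι : 𝒳 ⟶ projectiveSpace N ℂ ⊗ S), IsClosedImmersion ι.left ∧
        ι ≫ CartesianMonoidalCategory.snd (projectiveSpace N ℂ) S = f) ∧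
      IrreducibleSpace S.left ∧ Smooth S.hom ∧
      (∀ s : ComplexPoints S, IsRationalClass (complexBetti.map (fiberι f s) (2 * p) A) ∧
        IsOfHodgeType n (fiberOver f s) (2 * p) p p (complexBetti.map (fiberι f s) (2 * p) A)) ∧
      complexBetti.map e.hom (2 * p) (complexBetti.map (fiberι f s₁) (2 * p) A) = c ∧
      complexBetti.map (fiberι f s₀) (2 * p) A ∈ algebraicClasses (fiberOver f s₀) p := by
  haveI : ∀ s : AlgPoints (specOver ℂ ℂ) ℂ, IsIso (fiberι (toSpecOver X) s) :=
    isIso_fiberι_toSpecOver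
  refine ⟨X, specOver ℂ ℂ, toSpecOver X, 𝟙 _, 𝟙 _, (asIso (fiberι (toSpecOver X) (𝟙 _))).symm, c,
    isSmoothProjectiveFamily_toSpecOver hX, exists_isClosedImmersion_toSpecOver hX.isProjectiveOver,
    irreducibleSpace_specOver_left, smooth_specOver_hom, fun s ↦ ⟨?_, ?_⟩, ?_, ?_⟩
  · exact hc.pullback _
  · exact IsOfHodgeType.map_of_iso (asIso (fiberι (toSpecOver X) s)) hpp
  · change (complexBetti.map (asIso (fiberι (toSpecOver X) (𝟙 _))).hom (2 * p) ≫
      complexBetti.map (asIso (fiberι (toSpecOver X) (𝟙 _))).inv (2 * p)) c = c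
    rw [← complexBetti.map_comp, Iso.inv_hom_id, complexBetti.map_id]
    rfl
  · exact mem_algebraicClasses_map_of_iso hX
      ((isSmoothProjectiveFamily_toSpecOver hX).isSmoothProjective _)
      (asIso (fiberι (toSpecOver X) _)) halg

end ConstantFamily

/-- **`HodgeConjecture → V′`**: as for the crux as filed, HC on the smooth projective fibre `𝒳_s`
makes the rational `(p,p)` class `A|_{𝒳_s}` algebraic; embedding, base hypotheses and anchor unused
(Charles–Schnell Cor. 11.3.6). [cite: CharlesSchnell2014Notes, Cor. 11.3.6] -/
theorem anchorTransport_projVariationalHodge_of_hodgeConjecture (h : _root_.HodgeConjecture)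
    ⦃n : ℕ⦄ ⦃𝒳 S : SchemeOver ℂ⦄ (f : 𝒳 ⟶ S) (hf : IsSmoothProjectiveFamily f n)
    (_hι : ∃ (N : ℕ) (ι : 𝒳 ⟶ projectiveSpace N ℂ ⊗ S), IsClosedImmersion ι.left ∧
      ι ≫ CartesianMonoidalCategory.snd (projectiveSpace N ℂ) S = f)
    (_hirr : IrreducibleSpace S.left) (_hsm : Smooth S.hom) (p : ℕ) (A : complexBetti 𝒳 (2 * p))
    (hA : ∀ s : ComplexPoints S, IsRationalClass (complexBetti.map (fiberι f s) (2 * p) A) ∧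
      IsOfHodgeType n (fiberOver f s) (2 * p) p p (complexBetti.map (fiberι f s) (2 * p) A))
    (_hs₀ : ∃ s₀ : ComplexPoints S,
      complexBetti.map (fiberι f s₀) (2 * p) A ∈ algebraicClasses (fiberOver f s₀) p)
    (s : ComplexPoints S) :
    complexBetti.map (fiberι f s) (2 * p) A ∈ algebraicClasses (fiberOver f s) p :=
  (h (hf.isSmoothProjective s)).2 p _ (hA s).1 (hA s).2

/-- **`HodgeConjecture → An′`**: under HC every rational `(p,p)` class is algebraic, hence anchored
by the (relatively projective) constant family
(`anchorTransport_projAnchor_of_mem_algebraicClasses`). [folklore] -/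
theorem anchorTransport_projAnchorExistence_of_hodgeConjecture (h : _root_.HodgeConjecture)
    ⦃n : ℕ⦄ ⦃X : SchemeOver ℂ⦄ (hX : IsSmoothProjective n X) (p : ℕ) (c : complexBetti X (2 * p))
    (hc : IsRationalClass c) (hpp : IsOfHodgeType n X (2 * p) p p c) :
    ∃ (𝒳 S : SchemeOver ℂ) (f : 𝒳 ⟶ S) (s₁ s₀ : ComplexPoints S) (e : X ≅ fiberOver f s₁)
      (A : complexBetti 𝒳 (2 * p)),
      IsSmoothProjectiveFamily f n ∧
      (∃ (N : ℕ) (ι : 𝒳 ⟶ projectiveSpace N ℂ ⊗ S), IsClosedImmersion ι.left ∧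
        ι ≫ CartesianMonoidalCategory.snd (projectiveSpace N ℂ) S = f) ∧
      IrreducibleSpace S.left ∧ Smooth S.hom ∧
      (∀ s : ComplexPoints S, IsRationalClass (complexBetti.map (fiberι f s) (2 * p) A) ∧
        IsOfHodgeType n (fiberOver f s) (2 * p) p p (complexBetti.map (fiberι f s) (2 * p) A)) ∧
      complexBetti.map e.hom (2 * p) (complexBetti.map (fiberι f s₁) (2 * p) A) = c ∧
      complexBetti.map (fiberι f s₀) (2 * p) A ∈ algebraicClasses (fiberOver f s₀) p :=
  anchorTransport_projAnchor_of_mem_algebraicClasses hX p c hc hpp ((h hX).2 p c hc hpp)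

/-- **`(V′ ∧ An′) ↔ HodgeConjecture`**: the repaired target is equivalent to the summit statement
(forward `anchorTransport_hodgeConjecture_of_proj`; backward fibrewise HC and the relatively
projective constant-family anchor). [folklore] -/
theorem anchorTransport_projTarget_iff_hodgeConjecture :
    ((∀ ⦃n : ℕ⦄ ⦃𝒳 S : SchemeOver ℂ⦄ (f : 𝒳 ⟶ S), IsSmoothProjectiveFamily f n →
      (∃ (N : ℕ) (ι : 𝒳 ⟶ projectiveSpace N ℂ ⊗ S), IsClosedImmersion ι.left ∧
        ι ≫ CartesianMonoidalCategory.snd (projectiveSpace N ℂ) S = f) →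
      IrreducibleSpace S.left → Smooth S.hom → ∀ (p : ℕ) (A : complexBetti 𝒳 (2 * p)),
      (∀ s : ComplexPoints S, IsRationalClass (complexBetti.map (fiberι f s) (2 * p) A) ∧
        IsOfHodgeType n (fiberOver f s) (2 * p) p p (complexBetti.map (fiberι f s) (2 * p) A)) →
      (∃ s₀ : ComplexPoints S,
        complexBetti.map (fiberι f s₀) (2 * p) A ∈ algebraicClasses (fiberOver f s₀) p) →
      ∀ s : ComplexPoints S,
        complexBetti.map (fiberι f s) (2 * p) A ∈ algebraicClasses (fiberOver f s) p) ∧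
    (∀ ⦃n : ℕ⦄ ⦃X : SchemeOver ℂ⦄, IsSmoothProjective n X →
      ∀ (p : ℕ) (c : complexBetti X (2 * p)), IsRationalClass c → IsOfHodgeType n X (2 * p) p p c →
      ∃ (𝒳 S : SchemeOver ℂ) (f : 𝒳 ⟶ S) (s₁ s₀ : ComplexPoints S) (e : X ≅ fiberOver f s₁)
        (A : complexBetti 𝒳 (2 * p)),
        IsSmoothProjectiveFamily f n ∧
        (∃ (N : ℕ) (ι : 𝒳 ⟶ projectiveSpace N ℂ ⊗ S), IsClosedImmersion ι.left ∧
          ι ≫ CartesianMonoidalCategory.snd (projectiveSpace N ℂ) S = f) ∧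
        IrreducibleSpace S.left ∧ Smooth S.hom ∧
        (∀ s : ComplexPoints S, IsRationalClass (complexBetti.map (fiberι f s) (2 * p) A) ∧
          IsOfHodgeType n (fiberOver f s) (2 * p) p p (complexBetti.map (fiberι f s) (2 * p) A)) ∧
        complexBetti.map e.hom (2 * p) (complexBetti.map (fiberι f s₁) (2 * p) A) = c ∧
        complexBetti.map (fiberι f s₀) (2 * p) A ∈ algebraicClasses (fiberOver f s₀) p)) ↔
    _root_.HodgeConjecture :=
  ⟨fun h ↦ anchorTransport_hodgeConjecture_of_proj h.1 h.2,
    fun h ↦ ⟨anchorTransport_projVariationalHodge_of_hodgeConjecture h,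
      anchorTransport_projAnchorExistence_of_hodgeConjecture h⟩⟩

/-- **`(V′ ∧ An′) ↔ Target`**: the repaired target and the target as filed are equivalent — both
are equivalent to `HodgeConjecture` (`anchorTransport_projTarget_iff_hodgeConjecture`,
`anchorTransport_target_iff_hodgeConjecture`).  Restating the cruxes with relative projectivity
therefore changes the tools available to a prover of `VariationalHodge`, not the truth value of
item stmt-HodgeConjecture-1079. [folklore] -/
theorem anchorTransport_projTarget_iff_target :
    ((∀ ⦃n : ℕ⦄ ⦃𝒳 S : SchemeOver ℂ⦄ (f : 𝒳 ⟶ S), IsSmoothProjectiveFamily f n →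
      (∃ (N : ℕ) (ι : 𝒳 ⟶ projectiveSpace N ℂ ⊗ S), IsClosedImmersion ι.left ∧
        ι ≫ CartesianMonoidalCategory.snd (projectiveSpace N ℂ) S = f) →
      IrreducibleSpace S.left → Smooth S.hom → ∀ (p : ℕ) (A : complexBetti 𝒳 (2 * p)),
      (∀ s : ComplexPoints S, IsRationalClass (complexBetti.map (fiberι f s) (2 * p) A) ∧
        IsOfHodgeType n (fiberOver f s) (2 * p) p p (complexBetti.map (fiberι f s) (2 * p) A)) →
      (∃ s₀ : ComplexPoints S,
        complexBetti.map (fiberι f s₀) (2 * p) A ∈ algebraicClasses (fiberOver f s₀) p) →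
      ∀ s : ComplexPoints S,
        complexBetti.map (fiberι f s) (2 * p) A ∈ algebraicClasses (fiberOver f s) p) ∧
    (∀ ⦃n : ℕ⦄ ⦃X : SchemeOver ℂ⦄, IsSmoothProjective n X →
      ∀ (p : ℕ) (c : complexBetti X (2 * p)), IsRationalClass c → IsOfHodgeType n X (2 * p) p p c →
      ∃ (𝒳 S : SchemeOver ℂ) (f : 𝒳 ⟶ S) (s₁ s₀ : ComplexPoints S) (e : X ≅ fiberOver f s₁)
        (A : complexBetti 𝒳 (2 * p)),
        IsSmoothProjectiveFamily f n ∧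
        (∃ (N : ℕ) (ι : 𝒳 ⟶ projectiveSpace N ℂ ⊗ S), IsClosedImmersion ι.left ∧
          ι ≫ CartesianMonoidalCategory.snd (projectiveSpace N ℂ) S = f) ∧
        IrreducibleSpace S.left ∧ Smooth S.hom ∧
        (∀ s : ComplexPoints S, IsRationalClass (complexBetti.map (fiberι f s) (2 * p) A) ∧
          IsOfHodgeType n (fiberOver f s) (2 * p) p p (complexBetti.map (fiberι f s) (2 * p) A)) ∧
        complexBetti.map e.hom (2 * p) (complexBetti.map (fiberι f s₁) (2 * p) A) = c ∧
        complexBetti.map (fiberι f s₀) (2 * p) A ∈ algebraicClasses (fiberOver f s₀) p)) ↔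
    Target :=
  anchorTransport_projTarget_iff_hodgeConjecture.trans anchorTransport_target_iff_hodgeConjecture.symm

end Summit.HodgeConjecture.HodgeConjecture.Theorems

end
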